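import Mathlib
import Literature.NumberTheory.Sieve.LiouvillePolynomialValuesMajorArcMR
import Literature.NumberTheory.LFunctions.MatomakiRadziwillTaoTheoremA2
import Literature.NumberTheory.LFunctions.LiouvilleNonpretentious
import HarnessLib

/-!
# Teräväinen 2024, §5.4, major arcs for `g = λ`: `λ` along progressions in almost all short intervals

Support file (everything PROVED; no definitions, no named facts) towards the named fact
`Literature.NumberTheory.Sieve.teravainen2024_cor_2_1` (J. Teräväinen, *On the Liouville function
at polynomial arguments*, Amer. J. Math. 146 (2024) = arXiv:2010.07924, Corollary 2.1 ⊂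
Theorem 2.6 for `g_j = λ`, proved in §5). In Case 1 (major arcs) of the proof of Proposition 5.4
(§5.4, p. 14) the phase `e(-P_x^{(1)}(n))` with rational coefficients `a_i/q_i` is periodic modulo
`R = q_1 ⋯ q_k`, so "by splitting `n` into progressions moduli `R`" ((5.17)) the correlation
reduces to means of `g` along arithmetic progressions in short intervals, which the paper bounds
by "expanding out `1_{n' ≡ a (mod [Q,m])}` in terms of Dirichlet characters" ((5.18)) and the
Matomäki–Radziwiłł theorem for `g ξ` "for all natural numbers `y ≤ X`, apart from
`≪ X (log log H')/log H'` exceptions" (display after (5.19)).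

For `g = λ` this file carries out exactly these two reductions on top of the tree's
Matomäki–Radziwiłł bound for `λξ` (`LiouvillePolynomialValuesMajorArcMR.lean`, from MRT 2015
Thm 1.7 + (1.12)), in a DETERMINISTIC `L¹` form over the integer starting points `y < X` from
which "all but few `y`" follows by Markov's inequality:

* `Teravainen2024.liouville_mul_char_shortSum_integral_le_unif` — the bound of
  `liouville_mul_char_shortSum_integral_le` with a constant `C` independent of the character
  (the constants of MRT Thm 1.7 and of (1.12) are absolute; only the level condition
  `r log⁵ H ≤ log^{1/125} X` depends on the modulus);
* `Teravainen2024.sum_norm_windowSum_le_two_mul_integral` — discretisation: for `1`-bounded `F`,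
  `∑_{1≤k≤X} ‖∑_{k≤n<k+K} F(n)‖ ≤ 2 ∫_0^X ‖∑_{⌈x⌉≤n≤⌊x+K-1/2⌋} F(n)‖ dx` (on `x ∈ (k-1/2, k)` the
  real window has integer points `[k, k+K)`, as in the tree's `MRT2015.theoremA2_discrete`);
* `Teravainen2024.sum_Ioc_modEq_liouville_eq` — `n ≡ b (mod m)` with `g = gcd(b, m)`:
  `∑_{y<n≤y+H, n≡b (m)} λ(n) = λ(g) ∑_{⌊y/g⌋<n'≤⌊(y+H)/g⌋, n'≡b/g (m/g)} λ(n')` (complete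
  multiplicativity of `λ`);
* `Teravainen2024.norm_sum_filter_modEq_le_sum_char` — a coprime residue class through Dirichlet
  characters (Mathlib's orthogonality `DirichletCharacter.sum_char_inv_mul_char_eq`):
  `‖∑_{n∈S, n≡b (m)} F(n)‖ ≤ φ(m)⁻¹ ∑_χ ‖∑_{n∈S} χ(n)F(n)‖`;
* `Teravainen2024.sum_norm_charWindow_le`, `sum_range_comp_div_le`,
  `norm_sum_Ioc_le_norm_sum_Ico_add_one`, `loglog_div_log_le` — bookkeeping (per-character
  discretised bound, `g`-to-one reindexing, window length `±1`, the rate at `H/g ≥ H/(2m)`);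
* `Teravainen2024.sum_norm_liouville_progression_shortSum_le` — **the result**: an absolute
  `C ≥ 0` with `∑_{y<X} |∑_{y<n≤y+H, n≡b (m)} λ(n)| ≤ C (log log H/log(H/(2m)) + log^{-1/700} X) H X + X`
  for `1 ≤ m`, `b < m`, `16 m ≤ H ≤ X`, `m log⁵ H ≤ log^{1/125} X` (the rate is taken at
  `log(H/(2m))` because `t ↦ log log t / log t` decreases and the dilated windows have length
  `H/g ≥ H/(2m)`).

## References
* J. Teräväinen, Amer. J. Math. 146 (2024), no. 4, 1115–1167, §5.4, proof of Proposition 5.4,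
  Case 1, (5.17)–(5.19) and the display following (5.19) (arXiv:2010.07924, p. 14).
  [Teravainen2024]
* K. Matomäki, M. Radziwiłł, T. Tao, Algebra Number Theory 9 (2015), Theorem 1.7 and (1.12).
  [MatomakiRadziwillTao2015]
-/

noncomputable section

open Finset Complex MeasureTheory
open scoped ComplexConjugate

namespace Literature.NumberTheory.Sieve

namespace Teravainen2024

open Literature.NumberTheory.LFunctions

/-! ### Matomäki–Radziwiłł for `λξ`, uniformly in the character -/

/-- **Matomäki–Radziwiłł for `λξ` with a linear phase, constant uniform in `ξ`**: there is an
absolute `C` such that for every Dirichlet character `ξ` mod `r`, all `10 ≤ H ≤ X` with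
`r · log⁵ H ≤ log^{1/125} X` and all real `α`,
`∫_0^X |∑_{x≤n≤x+H} λ(n) ξ(n) e(αn)| dx ≤ C (log log H / log H + 1/log^{1/700} X) H X` (same proof
as `liouville_mul_char_shortSum_integral_le`, the constant being assembled from the absolute
constants of MRT 2015, Theorem 1.7 and (1.12) before `ξ` is chosen).
[cite: Teravainen2024, §5.4 (proof of Proposition 5.4, Case 1), for g = λ]
[cite: MatomakiRadziwillTao2015, Theorem 1.7 and (1.12)] -/
theorem liouville_mul_char_shortSum_integral_le_unif :
    ∃ C : ℝ, ∀ (r : ℕ) [NeZero r] (ξ : DirichletCharacter ℂ r) (H X : ℝ), 10 ≤ H → H ≤ X →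
      (r : ℝ) * Real.log H ^ (5 : ℝ) ≤ Real.log X ^ (1 / 125 : ℝ) → ∀ α : ℝ,
      ∫ x in (0 : ℝ)..X, ‖∑ n ∈ Finset.Icc ⌈x⌉₊ ⌊x + H⌋₊,
          (ArithmeticFunction.liouville : ArithmeticFunction ℂ) n * ξ n *
            Complex.exp (2 * Real.pi * Complex.I * (α : ℂ) * (n : ℂ))‖
        ≤ C * (Real.log (Real.log H) / Real.log H + 1 / Real.log X ^ (1 / 700 : ℝ)) * H * X := by
  obtain ⟨C₁, hC₁⟩ := MatomakiRadziwillTao2015_theorem17_holds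
  obtain ⟨C₂, X₀, h12⟩ :=
    MatomakiRadziwillTao2015_liouvilleDistLowerBound_holds.pretentiousDistSq_ge (1 / 6) (by norm_num)
  set L : ArithmeticFunction ℂ := (ArithmeticFunction.liouville : ArithmeticFunction ℂ) with hL
  set X₁ : ℝ := max X₀ (Real.exp (Real.exp 1)) with hX₁
  have hX₁e : Real.exp (Real.exp 1) ≤ X₁ := le_max_right _ _
  have hX₁pos : 0 < X₁ := lt_of_lt_of_le (Real.exp_pos _) hX₁e
  have hlogX₁ : 1 ≤ Real.log X₁ := by
    have : Real.exp 1 ≤ Real.log X₁ := by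
      rw [← Real.log_exp (Real.exp 1)]; exact Real.log_le_log (Real.exp_pos _) hX₁e
    linarith [Real.add_one_le_exp (1 : ℝ)]
  set C₁' : ℝ := max C₁ 0 with hC₁'
  set K : ℝ := max (C₁' * (Real.exp (C₂ / 20) + 1)) (2 * Real.log X₁ ^ (1 / 700 : ℝ)) with hK
  refine ⟨K, fun r _ ξ H X hH hHX hlev α => ?_⟩
  -- the arithmetic function `λξ`
  set g : ArithmeticFunction ℂ := ⟨fun n => L n * ξ n, by simp⟩ with hg_def
  have hg : ∀ n : ℕ, g n = L n * ξ n := fun n => rfl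
  have hgm : g.IsMultiplicative := isMultiplicative_of_eq_liouville_mul_char ξ hg
  have hg1 : ∀ n, ‖g n‖ ≤ 1 := norm_le_one_of_eq_liouville_mul_char ξ hg
  have hH0 : (0 : ℝ) < H := by linarith
  have hX0 : (0 : ℝ) < X := by linarith
  have hlogX : 0 < Real.log X := Real.log_pos (by linarith)
  have hlogH1 : 1 ≤ Real.log H := by
    rw [← Real.log_exp 1]
    exact Real.log_le_log (Real.exp_pos 1) (by have := Real.exp_one_lt_three; linarith)
  have hrate0 : 0 ≤ Real.log (Real.log H) / Real.log H + 1 / Real.log X ^ (1 / 700 : ℝ) := by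
    have : 0 ≤ Real.log (Real.log H) := Real.log_nonneg hlogH1
    positivity
  have hrate1 : 1 / Real.log X ^ (1 / 700 : ℝ)
      ≤ Real.log (Real.log H) / Real.log H + 1 / Real.log X ^ (1 / 700 : ℝ) := by
    have : 0 ≤ Real.log (Real.log H) / Real.log H := div_nonneg (Real.log_nonneg hlogH1) (by linarith)
    linarith
  -- the integrand of Theorem 1.7 for `g = λξ` is ours
  have hint : ∀ x : ℝ, (∑ n ∈ Finset.Icc ⌈x⌉₊ ⌊x + H⌋₊,
      g n * Complex.exp (2 * Real.pi * Complex.I * (α : ℂ) * (n : ℂ)))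
      = ∑ n ∈ Finset.Icc ⌈x⌉₊ ⌊x + H⌋₊,
          L n * ξ n * Complex.exp (2 * Real.pi * Complex.I * (α : ℂ) * (n : ℂ)) := fun x => rfl
  rcases le_or_gt X₁ X with hXX₁ | hXX₁
  · -- large `X`: Theorem 1.7 and (1.12)
    have hXX₀ : X₀ ≤ X := le_trans (le_max_left _ _) hXX₁
    have hlogX1 : 1 ≤ Real.log X := hlogX₁.trans (Real.log_le_log hX₁pos hXX₁)
    have h1 := hC₁ g hgm hg1 X H hH hHX α
    -- lower bound for `M(λξ; X, Q)`
    set Q : ℝ := min (Real.log X ^ (1 / 125 : ℝ)) (Real.log H ^ (5 : ℝ)) with hQ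
    have hQ1 : 1 ≤ Q := by
      rw [hQ, le_min_iff]
      exact ⟨Real.one_le_rpow hlogX1 (by norm_num), Real.one_le_rpow hlogH1 (by norm_num)⟩
    have hQle : Q ≤ Real.log H ^ (5 : ℝ) := min_le_right _ _
    have hr1 : (1 : ℝ) ≤ r := by exact_mod_cast Nat.one_le_iff_ne_zero.mpr (NeZero.ne r)
    have hM : (1 / 3 - 1 / 6) * Real.log (Real.log X) - C₂ ≤ Sieve.nonpretentiousness g X Q := by
      unfold Sieve.nonpretentiousness Sieve.charNonpretentiousness
      haveI : Nonempty (Set.Icc 1 ⌊Q⌋₊) :=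
        ⟨⟨1, Set.mem_Icc.2 ⟨le_rfl, Nat.le_floor (by exact_mod_cast hQ1)⟩⟩⟩
      refine le_ciInf fun q => ?_
      haveI : Nonempty (DirichletCharacter ℂ (q : ℕ)) := ⟨1⟩
      refine le_ciInf fun ψ => ?_
      haveI : Nonempty (Set.Icc (-X) X) := ⟨⟨0, Set.mem_Icc.2 ⟨by linarith, hX0.le⟩⟩⟩
      refine le_ciInf fun t => ?_
      have hq := q.2
      rw [Set.mem_Icc] at hq
      haveI : NeZero (q : ℕ) := ⟨by omega⟩
      rw [pretentiousDistSq_liouville_mul_char ξ hg]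
      refine h12 X hXX₀ (r * q) _ t (Nat.one_le_iff_ne_zero.mpr (mul_ne_zero (NeZero.ne r) (by omega)))
        ?_ (abs_le.2 (Set.mem_Icc.1 t.2))
      have hqQ : ((q : ℕ) : ℝ) ≤ Real.log H ^ (5 : ℝ) := by
        calc ((q : ℕ) : ℝ) ≤ ⌊Q⌋₊ := by exact_mod_cast hq.2
          _ ≤ Q := Nat.floor_le (by linarith)
          _ ≤ Real.log H ^ (5 : ℝ) := hQle
      calc ((r * q : ℕ) : ℝ) = (r : ℝ) * (q : ℕ) := by push_cast; ring
        _ ≤ (r : ℝ) * Real.log H ^ (5 : ℝ) := mul_le_mul_of_nonneg_left hqQ (by linarith)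
        _ ≤ Real.log X ^ (1 / 125 : ℝ) := hlev
    have hexp : Real.exp (-(Sieve.nonpretentiousness g X Q) / 20) ≤
        Real.exp (C₂ / 20) * (1 / Real.log X ^ (1 / 700 : ℝ)) := by
      have h2 : -(Sieve.nonpretentiousness g X Q) / 20 ≤
          C₂ / 20 + (-(1 / 120)) * Real.log (Real.log X) := by
        linarith
      calc Real.exp (-(Sieve.nonpretentiousness g X Q) / 20)
          ≤ Real.exp (C₂ / 20 + (-(1 / 120)) * Real.log (Real.log X)) := Real.exp_le_exp.2 h2
        _ = Real.exp (C₂ / 20) * Real.log X ^ (-(1 / 120) : ℝ) := by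
            rw [Real.exp_add, Real.rpow_def_of_pos hlogX, mul_comm (Real.log (Real.log X))]
        _ ≤ Real.exp (C₂ / 20) * Real.log X ^ (-(1 / 700) : ℝ) := by
            apply mul_le_mul_of_nonneg_left _ (Real.exp_pos _).le
            exact Real.rpow_le_rpow_of_exponent_le hlogX1 (by norm_num)
        _ = Real.exp (C₂ / 20) * (1 / Real.log X ^ (1 / 700 : ℝ)) := by
            rw [Real.rpow_neg hlogX.le, inv_eq_one_div]
    have hHX0 : 0 ≤ (H : ℝ) * X := by positivity
    set E : ℝ := Real.exp (-(Sieve.nonpretentiousness g X Q) / 20)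
      + Real.log (Real.log H) / Real.log H + 1 / Real.log X ^ (1 / 700 : ℝ) with hE
    have hE0 : 0 ≤ E := by
      have := Real.exp_pos (-(Sieve.nonpretentiousness g X Q) / 20); rw [hE]; linarith
    have h1' : ∫ x in (0 : ℝ)..X, ‖∑ n ∈ Finset.Icc ⌈x⌉₊ ⌊x + H⌋₊,
        L n * ξ n * Complex.exp (2 * Real.pi * Complex.I * (α : ℂ) * (n : ℂ))‖
          ≤ C₁' * E * H * X := by
      simp only [hint] at h1
      refine h1.trans ?_
      have e : ∀ c : ℝ, c * E * H * X = c * (E * (H * X)) := fun c => by ring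
      rw [e, e]
      exact mul_le_mul_of_nonneg_right (le_max_left _ _) (mul_nonneg hE0 hHX0)
    calc ∫ x in (0 : ℝ)..X, ‖∑ n ∈ Finset.Icc ⌈x⌉₊ ⌊x + H⌋₊,
          L n * ξ n * Complex.exp (2 * Real.pi * Complex.I * (α : ℂ) * (n : ℂ))‖
        ≤ C₁' * E * H * X := h1'
      _ ≤ C₁' * ((Real.exp (C₂ / 20) + 1)
            * (Real.log (Real.log H) / Real.log H + 1 / Real.log X ^ (1 / 700 : ℝ))) * H * X := by
          have hC0 : 0 ≤ C₁' := le_max_right _ _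
          apply mul_le_mul_of_nonneg_right _ hX0.le
          apply mul_le_mul_of_nonneg_right _ hH0.le
          apply mul_le_mul_of_nonneg_left _ hC0
          rw [hE]
          have := mul_le_mul_of_nonneg_left hrate1 (Real.exp_pos (C₂ / 20)).le
          nlinarith [hexp, hrate0]
      _ = (C₁' * (Real.exp (C₂ / 20) + 1))
            * (Real.log (Real.log H) / Real.log H + 1 / Real.log X ^ (1 / 700 : ℝ)) * H * X := by
          ring
      _ ≤ K * (Real.log (Real.log H) / Real.log H + 1 / Real.log X ^ (1 / 700 : ℝ)) * H * X := by
          apply mul_le_mul_of_nonneg_right _ hX0.le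
          apply mul_le_mul_of_nonneg_right _ hH0.le
          exact mul_le_mul_of_nonneg_right (le_max_left _ _) hrate0
  · -- small `X`: trivial bound
    have hbound : ∀ x ∈ Set.uIoc (0 : ℝ) X, ‖(‖∑ n ∈ Finset.Icc ⌈x⌉₊ ⌊x + H⌋₊,
        L n * ξ n * Complex.exp (2 * Real.pi * Complex.I * (α : ℂ) * (n : ℂ))‖)‖ ≤ H + 1 := by
      intro x hx
      rw [Set.uIoc_of_le hX0.le] at hx
      rw [norm_norm]
      refine (norm_sum_le _ _).trans ?_
      calc ∑ n ∈ Finset.Icc ⌈x⌉₊ ⌊x + H⌋₊,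
            ‖L n * ξ n * Complex.exp (2 * Real.pi * Complex.I * (α : ℂ) * (n : ℂ))‖
          ≤ ∑ n ∈ Finset.Icc ⌈x⌉₊ ⌊x + H⌋₊, (1 : ℝ) := by
            refine sum_le_sum fun n _ => ?_
            rw [norm_mul, ← hg n]
            have he : ‖Complex.exp (2 * Real.pi * Complex.I * (α : ℂ) * (n : ℂ))‖ = 1 := by
              have : 2 * Real.pi * Complex.I * (α : ℂ) * (n : ℂ) = ((2 * Real.pi * α * n : ℝ) : ℂ) * I := by
                push_cast
                ring
              rw [this, Complex.norm_exp_ofReal_mul_I]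
            rw [he, mul_one]
            exact hg1 n
        _ = #(Finset.Icc ⌈x⌉₊ ⌊x + H⌋₊) := by simp
        _ ≤ H + 1 := Tao2016.card_Icc_ceil_floor_le hx.1.le hH0.le
    have h1 := intervalIntegral.norm_integral_le_of_norm_le_const hbound
    rw [Real.norm_eq_abs, sub_zero, abs_of_pos hX0] at h1
    have h2 : ∫ x in (0 : ℝ)..X, ‖∑ n ∈ Finset.Icc ⌈x⌉₊ ⌊x + H⌋₊,
        L n * ξ n * Complex.exp (2 * Real.pi * Complex.I * (α : ℂ) * (n : ℂ))‖ ≤ (H + 1) * X :=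
      (le_abs_self _).trans h1
    have hlogle : Real.log X ≤ Real.log X₁ := Real.log_le_log hX0 hXX₁.le
    have hr : 1 ≤ Real.log X₁ ^ (1 / 700 : ℝ) * (1 / Real.log X ^ (1 / 700 : ℝ)) := by
      rw [mul_one_div, le_div_iff₀ (Real.rpow_pos_of_pos hlogX _), one_mul]
      exact Real.rpow_le_rpow hlogX.le hlogle (by norm_num)
    calc ∫ x in (0 : ℝ)..X, ‖∑ n ∈ Finset.Icc ⌈x⌉₊ ⌊x + H⌋₊,
          L n * ξ n * Complex.exp (2 * Real.pi * Complex.I * (α : ℂ) * (n : ℂ))‖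
        ≤ (H + 1) * X := h2
      _ ≤ 2 * H * X := by nlinarith
      _ ≤ 2 * H * X * (Real.log X₁ ^ (1 / 700 : ℝ) * (1 / Real.log X ^ (1 / 700 : ℝ))) :=
          le_mul_of_one_le_right (by positivity) hr
      _ = (2 * Real.log X₁ ^ (1 / 700 : ℝ)) * (1 / Real.log X ^ (1 / 700 : ℝ)) * H * X := by ring
      _ ≤ K * (Real.log (Real.log H) / Real.log H + 1 / Real.log X ^ (1 / 700 : ℝ)) * H * X := by
          apply mul_le_mul_of_nonneg_right _ hX0.le
          apply mul_le_mul_of_nonneg_right _ hH0.le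
          exact mul_le_mul (le_max_right _ _) hrate1 (by positivity)
            (le_trans (by positivity) (le_max_right _ _))

/-! ### Discretisation of the integral over the starting point -/

/-- The short sum `x ↦ ∑_{⌈x⌉ ≤ n ≤ ⌊x+h⌋} F(n)` is a measurable function of `x` (it factors
through `(⌈x⌉, ⌊x+h⌋)`). [folklore] -/
theorem measurable_norm_shortSum (F : ℕ → ℂ) (h : ℝ) :
    Measurable fun x : ℝ => ‖∑ n ∈ Finset.Icc ⌈x⌉₊ ⌊x + h⌋₊, F n‖ := by
  have h1 : Measurable fun x : ℝ => (⌈x⌉₊, ⌊x + h⌋₊) :=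
    Nat.measurable_ceil.prodMk (Nat.measurable_floor.comp (measurable_id.add_const _))
  have e : (fun x : ℝ => ‖∑ n ∈ Finset.Icc ⌈x⌉₊ ⌊x + h⌋₊, F n‖) = fun x : ℝ =>
      ‖(Function.uncurry (fun a b : ℕ => ∑ n ∈ Finset.Icc a b, F n) ∘
        (fun x : ℝ => (⌈x⌉₊, ⌊x + h⌋₊))) x‖ := by
    funext x
    simp only [Function.comp_apply, Function.uncurry_apply_pair]
  rw [e]
  exact ((measurable_of_countable (Function.uncurry fun a b : ℕ => ∑ n ∈ Finset.Icc a b, F n)).comp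
    h1).norm

/-- Interval integrability of the short-sum integrand. [folklore] -/
theorem intervalIntegrable_norm_shortSum {F : ℕ → ℂ} (hF : ∀ n, ‖F n‖ ≤ 1) {h : ℝ} (hh : 0 ≤ h)
    (a b : ℝ) :
    IntervalIntegrable (fun x : ℝ => ‖∑ n ∈ Finset.Icc ⌈x⌉₊ ⌊x + h⌋₊, F n‖) volume a b := by
  refine IntegrableOn.intervalIntegrable ?_
  refine Measure.integrableOn_of_bounded (M := h + 2) ?_
    (measurable_norm_shortSum F h).aestronglyMeasurable ?_
  · rw [Set.uIcc, Real.volume_Icc]; exact ENNReal.ofReal_ne_top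
  · exact Filter.Eventually.of_forall fun y => by
      rw [norm_norm]
      exact MRT2015.norm_sum_Icc_le hF hh y

/-- `∫_{k-1/2}^{k} ‖∑_{[x,x+K-1/2]} F‖ dx = (1/2) ‖∑_{[k, k+K)} F‖`. [folklore] -/
theorem integral_norm_shortSum_half (F : ℕ → ℂ) {k K : ℕ} (hk : 1 ≤ k) (hK : 1 ≤ K) :
    ∫ x in ((k : ℝ) - 1 / 2)..k, ‖∑ n ∈ Finset.Icc ⌈x⌉₊ ⌊x + ((K : ℝ) - 1 / 2)⌋₊, F n‖ =
      1 / 2 * ‖∑ n ∈ Finset.Ico k (k + K), F n‖ := by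
  rw [intervalIntegral.integral_of_le (by linarith), ← setIntegral_congr_set Ioo_ae_eq_Ioc,
    setIntegral_congr_fun measurableSet_Ioo (g := fun _ => ‖∑ n ∈ Finset.Ico k (k + K), F n‖)
      (fun x hx => by
        simp only
        rw [MRT2015.Icc_ceil_floor_eq_Ico hk hK hx]),
    setIntegral_const, Real.volume_real_Ioo_of_le (by linarith)]
  simp only [smul_eq_mul]
  ring

/-- **Discretisation** (the device of the tree's `MRT2015.theoremA2_discrete`): for a `1`-bounded
`F : ℕ → ℂ` and `K ≥ 1`,
`∑_{1≤k≤X} ‖∑_{k≤n<k+K} F(n)‖ ≤ 2 ∫_0^X ‖∑_{⌈x⌉≤n≤⌊x+K-1/2⌋} F(n)‖ dx`. [folklore] -/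
theorem sum_norm_windowSum_le_two_mul_integral {F : ℕ → ℂ} (hF : ∀ n, ‖F n‖ ≤ 1) {K : ℕ}
    (hK : 1 ≤ K) (X : ℕ) :
    ∑ k ∈ Finset.Icc 1 X, ‖∑ n ∈ Finset.Ico k (k + K), F n‖ ≤
      2 * ∫ x in (0 : ℝ)..X, ‖∑ n ∈ Finset.Icc ⌈x⌉₊ ⌊x + ((K : ℝ) - 1 / 2)⌋₊, F n‖ := by
  have hh : (0 : ℝ) ≤ (K : ℝ) - 1 / 2 := by
    have : (1 : ℝ) ≤ K := by exact_mod_cast hK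
    linarith
  set G : ℝ → ℝ := fun x => ‖∑ n ∈ Finset.Icc ⌈x⌉₊ ⌊x + ((K : ℝ) - 1 / 2)⌋₊, F n‖ with hG
  -- split the integral at the integers
  have hadj := intervalIntegral.sum_integral_adjacent_intervals (f := G) (μ := volume)
    (a := fun i : ℕ => ((i : ℕ) : ℝ)) (n := X)
    (fun i _ => intervalIntegrable_norm_shortSum hF hh _ _)
  simp only [Nat.cast_zero] at hadj
  rw [← hadj, Finset.mul_sum]
  -- reindex `Icc 1 X` by `k = i + 1`
  have hIcc : Finset.Icc 1 X = (Finset.range X).image (fun i => i + 1) := by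
    ext k
    simp only [Finset.mem_Icc, Finset.mem_image, Finset.mem_range]
    constructor
    · intro h; exact ⟨k - 1, by omega, by omega⟩
    · rintro ⟨i, hi, rfl⟩; omega
  rw [hIcc, Finset.sum_image (fun i _ j _ h => by omega)]
  refine Finset.sum_le_sum fun i _ => ?_
  have hk1 : 1 ≤ i + 1 := by omega
  have hhalf := integral_norm_shortSum_half F (k := i + 1) hk1 hK
  have e1 : (((i + 1 : ℕ) : ℝ) - 1 / 2) = (i : ℝ) + 1 / 2 := by push_cast; ring
  rw [e1] at hhalf
  -- `∫_i^{i+1} G ≥ ∫_{i+1/2}^{i+1} G = (1/2)‖window‖`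
  have hmono : ∫ x in ((i : ℝ) + 1 / 2)..((i + 1 : ℕ) : ℝ), G x ≤ ∫ x in ((i : ℕ) : ℝ)..((i + 1 : ℕ) : ℝ), G x := by
    push_cast
    exact intervalIntegral.integral_mono_interval (by linarith) (by linarith) le_rfl
      (Filter.Eventually.of_forall fun y => norm_nonneg _)
      (intervalIntegrable_norm_shortSum hF hh _ _)
  calc ‖∑ n ∈ Finset.Ico (i + 1) (i + 1 + K), F n‖
      = 2 * ∫ x in ((i : ℝ) + 1 / 2)..((i + 1 : ℕ) : ℝ), G x := by rw [hG, hhalf]; ring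
    _ ≤ 2 * ∫ x in ((i : ℕ) : ℝ)..((i + 1 : ℕ) : ℝ), G x :=
        mul_le_mul_of_nonneg_left hmono (by norm_num)

/-! ### Progressions `n ≡ b (mod m)`: extracting `gcd(b, m)` -/

/-- Division with remainder of a sum: `y/g + H/g ≤ (y+H)/g ≤ y/g + H/g + 1`. [folklore] -/
theorem add_div_bounds (y H : ℕ) {g : ℕ} (hg : 0 < g) :
    y / g + H / g ≤ (y + H) / g ∧ (y + H) / g ≤ y / g + H / g + 1 := by
  refine ⟨Nat.add_div_le_add_div y H g, ?_⟩
  have h1 := Nat.div_add_mod y g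
  have h2 := Nat.div_add_mod H g
  have h3 := Nat.mod_lt y hg
  have h4 := Nat.mod_lt H hg
  have h5 : y + H = g * (y / g + H / g) + (y % g + H % g) := by
    rw [mul_add]; omega
  have h6 : (y + H) / g = y / g + H / g + (y % g + H % g) / g := by
    conv_lhs => rw [h5]
    rw [Nat.mul_add_div hg]
  have h7 : (y % g + H % g) / g ≤ 1 := by
    apply Nat.le_of_lt_succ
    rw [Nat.div_lt_iff_lt_mul hg]
    omega
  omega

/-- **Extracting the gcd from a progression of `λ`.** For `1 ≤ m`, `b < m`, `g = gcd(b, m)`: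
`∑_{y<n≤y+H, n≡b (m)} λ(n) = λ(g) ∑_{⌊y/g⌋<n'≤⌊(y+H)/g⌋, n'≡b/g (m/g)} λ(n')` (`n = g n'`;
`λ` is completely multiplicative). [cite: Teravainen2024, §5.4 (5.18), for g = λ] -/
theorem sum_Ioc_modEq_liouville_eq {m b : ℕ} (hm : 1 ≤ m) (hb : b < m) (y H : ℕ) :
    ∑ n ∈ (Finset.Ioc y (y + H)).filter (fun n => n % m = b),
        (ArithmeticFunction.liouville : ArithmeticFunction ℂ) n =
      (ArithmeticFunction.liouville : ArithmeticFunction ℂ) (Nat.gcd b m) *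
        ∑ n' ∈ (Finset.Ioc (y / Nat.gcd b m) ((y + H) / Nat.gcd b m)).filter
            (fun n' => n' % (m / Nat.gcd b m) = b / Nat.gcd b m),
          (ArithmeticFunction.liouville : ArithmeticFunction ℂ) n' := by
  set g := Nat.gcd b m with hgdef
  have hg : 0 < g := Nat.gcd_pos_of_pos_right b (by omega)
  have hgm : g ∣ m := Nat.gcd_dvd_right b m
  have hgb : g ∣ b := Nat.gcd_dvd_left b m
  obtain ⟨m', hm'⟩ := hgm
  obtain ⟨b', hb'⟩ := hgb
  have hm'eq : m / g = m' := by rw [hm', Nat.mul_div_cancel_left _ hg]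
  have hb'eq : b / g = b' := by rw [hb', Nat.mul_div_cancel_left _ hg]
  have hm'pos : 0 < m' := by
    rcases Nat.eq_zero_or_pos m' with h | h
    · rw [h, mul_zero] at hm'; omega
    · exact h
  have hb'm' : b' < m' := by
    by_contra h
    rw [not_lt] at h
    have : m ≤ b := by rw [hm', hb']; exact Nat.mul_le_mul_left g h
    omega
  rw [hm'eq, hb'eq, Finset.mul_sum]
  simp_rw [← liouville_complex_apply_mul]
  -- the bijection `n ↦ n / g`, `n' ↦ g n'`
  refine Finset.sum_nbij' (fun n => n / g) (fun n' => g * n') ?_ ?_ ?_ ?_ ?_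
  · -- `n ↦ n/g` lands in the target
    intro n hn
    rw [Finset.mem_filter, Finset.mem_Ioc] at hn
    obtain ⟨⟨hyn, hnH⟩, hnb⟩ := hn
    have hgn : g ∣ n := by
      have h := Nat.div_add_mod n m
      rw [hnb] at h
      rw [← h, hm', hb', mul_assoc]
      exact (Nat.dvd_add_right (dvd_mul_right g _)).mpr (dvd_mul_right g b')
    obtain ⟨q, hq⟩ := hgn
    rw [Finset.mem_filter, Finset.mem_Ioc, hq, Nat.mul_div_cancel_left _ hg]
    refine ⟨⟨?_, ?_⟩, ?_⟩
    · -- `y / g < q` as `g q = n > y`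
      by_contra h
      rw [not_lt] at h
      have : g * q ≤ g * (y / g) := Nat.mul_le_mul_left g h
      have : g * (y / g) ≤ y := Nat.mul_div_le y g
      omega
    · -- `q ≤ (y+H)/g`
      rw [Nat.le_div_iff_mul_le hg, mul_comm]; omega
    · -- residue: `n = m (n/m) + b` gives `q = m' (n/m) + b'`
      have h := Nat.div_add_mod n m
      rw [hnb, hq, hm', hb'] at h
      -- `g * q = g * m' * (n/m) + g * b'`
      have h2 : q = m' * (g * q / (g * m')) + b' := by
        apply Nat.eq_of_mul_eq_mul_left hg
        calc g * q = g * m' * (g * q / (g * m')) + g * b' := h.symm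
          _ = g * (m' * (g * q / (g * m')) + b') := by ring
      rw [h2, Nat.mul_add_mod, Nat.mod_eq_of_lt hb'm']
  · -- `n' ↦ g n'` lands in the source
    intro n' hn'
    rw [Finset.mem_filter, Finset.mem_Ioc] at hn'
    obtain ⟨⟨hyn', hn'H⟩, hn'b⟩ := hn'
    rw [Finset.mem_filter, Finset.mem_Ioc]
    refine ⟨⟨?_, ?_⟩, ?_⟩
    · -- `y < g n'` from `y/g < n'`
      have h1 : y / g + 1 ≤ n' := hyn'
      have h2 : y < g * (y / g + 1) := by
        have := Nat.div_add_mod y g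
        have := Nat.mod_lt y hg
        rw [mul_add, mul_one]; omega
      calc y < g * (y / g + 1) := h2
        _ ≤ g * n' := Nat.mul_le_mul_left g h1
    · calc g * n' ≤ g * ((y + H) / g) := Nat.mul_le_mul_left g hn'H
        _ ≤ y + H := Nat.mul_div_le (y + H) g
    · -- residue
      rw [hm', hb', Nat.mul_mod_mul_left, hn'b]
  · intro n hn
    rw [Finset.mem_filter, Finset.mem_Ioc] at hn
    have hgn : g ∣ n := by
      have h := Nat.div_add_mod n m
      rw [hn.2] at h
      rw [← h, hm', hb', mul_assoc]
      exact (Nat.dvd_add_right (dvd_mul_right g _)).mpr (dvd_mul_right g b')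
    exact Nat.mul_div_cancel' hgn
  · intro n' _
    exact Nat.mul_div_cancel_left _ hg
  · intro n hn
    rw [Finset.mem_filter, Finset.mem_Ioc] at hn
    have hgn : g ∣ n := by
      have h := Nat.div_add_mod n m
      rw [hn.2] at h
      rw [← h, hm', hb', mul_assoc]
      exact (Nat.dvd_add_right (dvd_mul_right g _)).mpr (dvd_mul_right g b')
    simp only [Nat.mul_div_cancel' hgn]

/-! ### A coprime residue class through Dirichlet characters -/

/-- **Orthogonality** ("expanding out `1_{n ≡ a}` in terms of Dirichlet characters",
Teräväinen 2024, (5.18)): for `b` coprime to `m` and any finite set `S` and `F : ℕ → ℂ`,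
`‖∑_{n∈S, n≡b (m)} F(n)‖ ≤ φ(m)⁻¹ ∑_{χ (mod m)} ‖∑_{n∈S} χ(n) F(n)‖` (Mathlib's
`DirichletCharacter.sum_char_inv_mul_char_eq`). [cite: Teravainen2024, §5.4 (5.18)] -/
theorem norm_sum_filter_modEq_le_sum_char {m : ℕ} [NeZero m] {b : ℕ} (hb : Nat.Coprime b m)
    (S : Finset ℕ) (F : ℕ → ℂ) :
    ‖∑ n ∈ S.filter (fun n => n % m = b % m), F n‖ ≤
      (m.totient : ℝ)⁻¹ * ∑ χ : DirichletCharacter ℂ m, ‖∑ n ∈ S, χ n * F n‖ := by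
  classical
  set u : (ZMod m)ˣ := ZMod.unitOfCoprime b hb with hu_def
  have hu : ((u : ZMod m)) = (b : ZMod m) := ZMod.coe_unitOfCoprime b hb
  have hφpos : 0 < (Nat.totient m : ℝ) := by exact_mod_cast Nat.totient_pos.mpr (NeZero.pos m)
  have hφne : (Nat.totient m : ℂ) ≠ 0 := by exact_mod_cast hφpos.ne'
  -- orthogonality, per `n`
  have horth : ∀ n : ℕ, (if n % m = b % m then F n else 0) =
      (Nat.totient m : ℂ)⁻¹ * ∑ χ : DirichletCharacter ℂ m, χ (u : ZMod m)⁻¹ * χ (n : ZMod m) * F n := by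
    intro n
    rw [← Finset.sum_mul, DirichletCharacter.sum_char_inv_mul_char_eq ℂ u.isUnit, hu]
    have hiff : ((b : ZMod m) = (n : ZMod m)) ↔ (n % m = b % m) := by
      rw [ZMod.natCast_eq_natCast_iff']
      exact ⟨fun h => h.symm, fun h => h.symm⟩
    by_cases h1 : n % m = b % m
    · rw [if_pos h1, if_pos (hiff.mpr h1), ← mul_assoc, inv_mul_cancel₀ hφne, one_mul]
    · rw [if_neg h1, if_neg (fun h => h1 (hiff.mp h)), zero_mul, mul_zero]
  have h1 : ∑ n ∈ S.filter (fun n => n % m = b % m), F n =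
      (Nat.totient m : ℂ)⁻¹ * ∑ χ : DirichletCharacter ℂ m,
        χ (u : ZMod m)⁻¹ * ∑ n ∈ S, χ (n : ZMod m) * F n := by
    rw [Finset.sum_filter, Finset.sum_congr rfl fun n _ => horth n, ← Finset.mul_sum,
      Finset.sum_comm]
    congr 1
    refine Finset.sum_congr rfl fun χ _ => ?_
    rw [Finset.mul_sum]
    refine Finset.sum_congr rfl fun n _ => ?_
    ring
  rw [h1, norm_mul, norm_inv, Complex.norm_natCast]
  apply mul_le_mul_of_nonneg_left _ (by positivity)
  refine (norm_sum_le _ _).trans (Finset.sum_le_sum fun χ _ => ?_)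
  rw [norm_mul]
  calc ‖χ (u : ZMod m)⁻¹‖ * ‖∑ n ∈ S, χ (n : ZMod m) * F n‖ ≤ 1 * ‖∑ n ∈ S, χ (n : ZMod m) * F n‖ :=
        mul_le_mul_of_nonneg_right (χ.norm_le_one _) (norm_nonneg _)
    _ = ‖∑ n ∈ S, χ n * F n‖ := by rw [one_mul]

/-! ### Assembly -/

/-- **Per-character bound**: the discretised Matomäki–Radziwiłł bound for `χλ` over the integer
windows `[k, k+K)`, `1 ≤ k ≤ X`. [cite: Teravainen2024, §5.4 (display after (5.19)), for g = λ] -/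
theorem sum_norm_charWindow_le {C : ℝ}
    (hA : ∀ (r : ℕ) [NeZero r] (ξ : DirichletCharacter ℂ r) (H X : ℝ), 10 ≤ H → H ≤ X →
      (r : ℝ) * Real.log H ^ (5 : ℝ) ≤ Real.log X ^ (1 / 125 : ℝ) → ∀ α : ℝ,
      ∫ x in (0 : ℝ)..X, ‖∑ n ∈ Finset.Icc ⌈x⌉₊ ⌊x + H⌋₊,
          (ArithmeticFunction.liouville : ArithmeticFunction ℂ) n * ξ n *
            Complex.exp (2 * Real.pi * Complex.I * (α : ℂ) * (n : ℂ))‖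
        ≤ C * (Real.log (Real.log H) / Real.log H + 1 / Real.log X ^ (1 / 700 : ℝ)) * H * X)
    {r : ℕ} [NeZero r] (χ : DirichletCharacter ℂ r) {K X : ℕ} (hK : 11 ≤ K) (hKX : K ≤ X)
    (hlev : (r : ℝ) * Real.log ((K : ℝ) - 1 / 2) ^ (5 : ℝ) ≤ Real.log X ^ (1 / 125 : ℝ)) :
    ∑ k ∈ Finset.Icc 1 X, ‖∑ n ∈ Finset.Ico k (k + K),
        χ n * (ArithmeticFunction.liouville : ArithmeticFunction ℂ) n‖ ≤
      2 * (C * (Real.log (Real.log ((K : ℝ) - 1 / 2)) / Real.log ((K : ℝ) - 1 / 2) +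
        1 / Real.log X ^ (1 / 700 : ℝ)) * ((K : ℝ) - 1 / 2) * X) := by
  set F : ℕ → ℂ := fun n => χ n * (ArithmeticFunction.liouville : ArithmeticFunction ℂ) n with hF
  have hF1 : ∀ n, ‖F n‖ ≤ 1 := by
    intro n
    rw [hF]
    simp only
    rw [norm_mul]
    have h1 := χ.norm_le_one (n : ZMod r)
    have h2 := norm_liouville_complex_le_one n
    have h0 := norm_nonneg (χ (n : ZMod r))
    nlinarith
  have hK1 : 1 ≤ K := by omega
  have hKR : (11 : ℝ) ≤ K := by exact_mod_cast hK
  have hB := sum_norm_windowSum_le_two_mul_integral hF1 hK1 X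
  have hA' := hA r χ ((K : ℝ) - 1 / 2) X (by linarith) (by
    have : (K : ℝ) ≤ X := by exact_mod_cast hKX
    linarith) hlev 0
  -- the two integrands agree
  have hint : ∫ x in (0 : ℝ)..X, ‖∑ n ∈ Finset.Icc ⌈x⌉₊ ⌊x + ((K : ℝ) - 1 / 2)⌋₊, F n‖ =
      ∫ x in (0 : ℝ)..X, ‖∑ n ∈ Finset.Icc ⌈x⌉₊ ⌊x + ((K : ℝ) - 1 / 2)⌋₊,
          (ArithmeticFunction.liouville : ArithmeticFunction ℂ) n * χ n *
            Complex.exp (2 * Real.pi * Complex.I * ((0 : ℝ) : ℂ) * (n : ℂ))‖ := by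
    refine intervalIntegral.integral_congr fun x _ => ?_
    simp only [hF]
    congr 1
    refine Finset.sum_congr rfl fun n _ => ?_
    simp [mul_comm]
  rw [hint] at hB
  exact hB.trans (mul_le_mul_of_nonneg_left hA' (by norm_num))

/-- Summing a nonnegative function along `y ↦ ⌊y/g⌋ + 1` over `y < X`: each value `k ∈ [1, X]`
is hit at most `g` times. [folklore] -/
theorem sum_range_comp_div_le {f : ℕ → ℝ} (hf : ∀ k, 0 ≤ f k) {g : ℕ} (hg : 1 ≤ g) (X : ℕ) :
    ∑ y ∈ Finset.range X, f (y / g + 1) ≤ g * ∑ k ∈ Finset.Icc 1 X, f k := by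
  classical
  have hmaps : ∀ y ∈ Finset.range X, y / g + 1 ∈ Finset.Icc 1 X := by
    intro y hy
    rw [Finset.mem_range] at hy
    rw [Finset.mem_Icc]
    have h1 : y / g ≤ y := Nat.div_le_self y g
    generalize y / g = q at h1 ⊢
    exact ⟨by omega, by omega⟩
  rw [← Finset.sum_fiberwise_of_maps_to hmaps, Finset.mul_sum]
  refine Finset.sum_le_sum fun k hk => ?_
  rw [Finset.mem_Icc] at hk
  have hfib : ∀ y ∈ (Finset.range X).filter (fun y => y / g + 1 = k), f (y / g + 1) = f k := by
    intro y hy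
    rw [(Finset.mem_filter.mp hy).2]
  rw [Finset.sum_congr rfl hfib, Finset.sum_const, nsmul_eq_mul]
  apply mul_le_mul_of_nonneg_right _ (hf k)
  -- the fibre lies in `[g(k-1), g(k-1) + g)`
  have hsub : (Finset.range X).filter (fun y => y / g + 1 = k) ⊆
      Finset.Ico (g * (k - 1)) (g * (k - 1) + g) := by
    intro y hy
    rw [Finset.mem_filter] at hy
    have h3 : y / g = k - 1 := by
      have h := hy.2
      generalize y / g = q at h ⊢
      omega
    have h4 := Nat.div_mul_le_self y g
    have h5 := Nat.lt_div_mul_add (a := y) (show 0 < g by omega)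
    rw [h3, Nat.mul_comm] at h4 h5
    rw [Finset.mem_Ico]
    exact ⟨h4, h5⟩
  calc ((#((Finset.range X).filter (fun y => y / g + 1 = k)) : ℕ) : ℝ)
      ≤ #(Finset.Ico (g * (k - 1)) (g * (k - 1) + g)) := by exact_mod_cast Finset.card_le_card hsub
    _ = g := by rw [Nat.card_Ico, Nat.add_sub_cancel_left]

/-- Adjusting the window length by one: if `a + K ≤ c ≤ a + K + 1` and `F` is `1`-bounded then
`‖∑_{a<n≤c} F(n)‖ ≤ ‖∑_{a+1≤n<a+1+K} F(n)‖ + 1`. [folklore] -/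
theorem norm_sum_Ioc_le_norm_sum_Ico_add_one {F : ℕ → ℂ} (hF : ∀ n, ‖F n‖ ≤ 1) {a c K : ℕ}
    (h1 : a + K ≤ c) (h2 : c ≤ a + K + 1) :
    ‖∑ n ∈ Finset.Ioc a c, F n‖ ≤ ‖∑ n ∈ Finset.Ico (a + 1) (a + 1 + K), F n‖ + 1 := by
  have hIoc : Finset.Ioc a c = Finset.Ico (a + 1) (c + 1) := by
    ext n; simp only [Finset.mem_Ioc, Finset.mem_Ico]; omega
  rw [hIoc]
  rcases Nat.eq_or_lt_of_le h2 with hc | hc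
  · -- one extra term
    rw [hc, show a + K + 1 + 1 = (a + 1 + K) + 1 by ring, Finset.sum_Ico_succ_top (by omega)]
    refine (norm_add_le _ _).trans ?_
    linarith [hF (a + 1 + K)]
  · have hc' : c = a + K := by omega
    rw [hc', show a + K + 1 = a + 1 + K by ring]
    linarith [norm_nonneg (∑ n ∈ Finset.Ico (a + 1) (a + 1 + K), F n)]

/-- Rate comparison: for `16 m ≤ H`, `1 ≤ m` and `H/(2m) ≤ K' ≤ H`,
`log log K'/log K' ≤ log log H / log(H/(2m))`. [folklore] -/
theorem loglog_div_log_le {m H K' : ℝ} (hm : 1 ≤ m) (hH : 16 * m ≤ H) (hK1 : H / (2 * m) ≤ K')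
    (hK2 : K' ≤ H) :
    Real.log (Real.log K') / Real.log K' ≤ Real.log (Real.log H) / Real.log (H / (2 * m)) := by
  have hm0 : 0 < m := by linarith
  have hH2m : 8 ≤ H / (2 * m) := by rw [le_div_iff₀ (by linarith)]; linarith
  have hK8 : 8 ≤ K' := le_trans hH2m hK1
  have hH16 : 16 ≤ H := le_trans (by linarith) hH
  have he : Real.exp 1 < 3 := Real.exp_one_lt_three
  have hlogK : 1 < Real.log K' := by
    rw [Real.lt_log_iff_exp_lt (by linarith)]; linarith
  have hlogH2m : 1 < Real.log (H / (2 * m)) := by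
    rw [Real.lt_log_iff_exp_lt (by linarith)]; linarith
  have hlogH : 1 < Real.log H := by
    rw [Real.lt_log_iff_exp_lt (by linarith)]; linarith
  have hllK0 : 0 ≤ Real.log (Real.log K') := Real.log_nonneg hlogK.le
  have hllH0 : 0 ≤ Real.log (Real.log H) := Real.log_nonneg hlogH.le
  have h1 : Real.log (Real.log K') ≤ Real.log (Real.log H) :=
    Real.log_le_log (by linarith) (Real.log_le_log (by linarith) hK2)
  have h2 : Real.log (H / (2 * m)) ≤ Real.log K' := Real.log_le_log (by linarith) hK1
  calc Real.log (Real.log K') / Real.log K' ≤ Real.log (Real.log H) / Real.log K' :=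
        div_le_div_of_nonneg_right h1 (by linarith)
    _ ≤ Real.log (Real.log H) / Real.log (H / (2 * m)) :=
        div_le_div_of_nonneg_left hllH0 (by linarith) h2

/-- **`λ` along progressions in almost all short intervals** (Teräväinen 2024, §5.4, Case 1, for
`g = λ`: (5.18) + the Matomäki–Radziwiłł theorem for `λξ`), deterministic `L¹` form: there is an
absolute `C ≥ 0` such that for all `1 ≤ m`, `b < m`, `16 m ≤ H ≤ X` with
`m · log⁵ H ≤ log^{1/125} X`,
`∑_{y<X} |∑_{y<n≤y+H, n≡b (m)} λ(n)| ≤ C (log log H / log(H/(2m)) + log^{-1/700} X) H X + X`.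
(For most `y`, the mean of `λ` along the progression `n ≡ b (m)` in `(y, y+H]` is therefore small,
by Markov's inequality.) [cite: Teravainen2024, §5.4 (proof of Proposition 5.4, Case 1:
(5.18)–(5.19) and the display after it), for g = λ] -/
theorem sum_norm_liouville_progression_shortSum_le :
    ∃ C : ℝ, 0 ≤ C ∧ ∀ (m b H X : ℕ), 1 ≤ m → b < m → 16 * m ≤ H → H ≤ X →
      (m : ℝ) * Real.log H ^ (5 : ℝ) ≤ Real.log X ^ (1 / 125 : ℝ) →
      ∑ y ∈ Finset.range X, ‖∑ n ∈ (Finset.Ioc y (y + H)).filter (fun n => n % m = b),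
          (ArithmeticFunction.liouville : ArithmeticFunction ℂ) n‖ ≤
        C * (Real.log (Real.log H) / Real.log (H / (2 * m)) + 1 / Real.log X ^ (1 / 700 : ℝ)) *
          H * X + X := by
  classical
  obtain ⟨C₀, hA⟩ := liouville_mul_char_shortSum_integral_le_unif
  set C₁ : ℝ := max C₀ 0 with hC₁
  refine ⟨2 * C₁, by positivity, fun m b H X hm hb hH hHX hlev => ?_⟩
  set Lf : ArithmeticFunction ℂ := (ArithmeticFunction.liouville : ArithmeticFunction ℂ) with hLf
  -- the gcd data
  set g := Nat.gcd b m with hgdef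
  have hg : 0 < g := Nat.gcd_pos_of_pos_right b (by omega)
  have hgm : g ∣ m := Nat.gcd_dvd_right b m
  have hgle : g ≤ m := Nat.le_of_dvd (by omega) hgm
  set m' := m / g with hm'def
  set b' := b / g with hb'def
  have hm'pos : 0 < m' := Nat.div_pos hgle hg
  haveI : NeZero m' := ⟨by omega⟩
  have hcop : Nat.Coprime b' m' := Nat.coprime_div_gcd_div_gcd hg
  have hb'm' : b' < m' := by
    rw [hb'def, hm'def]
    obtain ⟨mm, hmm⟩ := hgm
    have hgb : g ∣ b := Nat.gcd_dvd_left b m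
    obtain ⟨bb, hbb⟩ := hgb
    rw [hmm, hbb, Nat.mul_div_cancel_left _ hg, Nat.mul_div_cancel_left _ hg]
    by_contra h
    rw [not_lt] at h
    have : m ≤ b := by rw [hmm, hbb]; exact Nat.mul_le_mul_left g h
    omega
  have hm'le : (m' : ℝ) ≤ m := by exact_mod_cast Nat.div_le_self m g
  -- the window length `K = H / g`
  set K := H / g with hKdef
  have hK16 : 16 ≤ K := by
    rw [hKdef, Nat.le_div_iff_mul_le hg]
    calc 16 * g ≤ 16 * m := Nat.mul_le_mul_left 16 hgle
      _ ≤ H := hH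
  have hKH : K ≤ H := Nat.div_le_self H g
  have hKX : K ≤ X := hKH.trans hHX
  have hgK : (g : ℝ) * K ≤ H := by
    have : g * K ≤ H := by rw [hKdef]; exact Nat.mul_div_le H g
    exact_mod_cast this
  -- real-number facts
  have hmR : (1 : ℝ) ≤ m := by exact_mod_cast hm
  have hHR : (16 : ℝ) * m ≤ H := by exact_mod_cast hH
  have hKR : (16 : ℝ) ≤ K := by exact_mod_cast hK16
  have hXR : (K : ℝ) ≤ X := by exact_mod_cast hKX
  have hKHR : (K : ℝ) ≤ H := by exact_mod_cast hKH
  set K' : ℝ := (K : ℝ) - 1 / 2 with hK'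
  have hK'10 : 10 ≤ K' := by rw [hK']; linarith
  have hK'H : K' ≤ H := by rw [hK']; linarith
  have hK'low : (H : ℝ) / (2 * m) ≤ K' := by
    -- `K ≥ H/g - 1 ≥ H/m - 1` and `H/m - 3/2 ≥ H/(2m)` as `H ≥ 3m`
    have h1 : (H : ℝ) / g - 1 ≤ K := by
      have h2 : (H : ℝ) / g < K + 1 := by
        have h3 : H < g * (H / g) + g := by
          have := Nat.div_add_mod H g; have := Nat.mod_lt H hg; omega
        have h4 : (H : ℝ) < g * K + g := by rw [hKdef]; exact_mod_cast h3
        have hgR : (0 : ℝ) < g := by exact_mod_cast hg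
        rw [div_lt_iff₀ hgR]; nlinarith
      linarith
    have hgR : (0 : ℝ) < g := by exact_mod_cast hg
    have hgleR : (g : ℝ) ≤ m := by exact_mod_cast hgle
    have h5 : (H : ℝ) / m ≤ H / g := div_le_div_of_nonneg_left (by positivity) hgR hgleR
    have h6 : (H : ℝ) / (2 * m) + 3 / 2 ≤ H / m := by
      rw [div_add' _ _ _ (by positivity), div_le_div_iff₀ (by positivity) (by positivity)]
      nlinarith
    rw [hK']; linarith
  -- the level condition for the modulus `m'` and the length `K'`
  have hlev' : (m' : ℝ) * Real.log K' ^ (5 : ℝ) ≤ Real.log X ^ (1 / 125 : ℝ) := by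
    refine le_trans ?_ hlev
    have hlogK' : 0 ≤ Real.log K' := Real.log_nonneg (by linarith)
    have hlogle : Real.log K' ≤ Real.log H := Real.log_le_log (by linarith) hK'H
    exact mul_le_mul hm'le (Real.rpow_le_rpow hlogK' hlogle (by norm_num)) (by positivity)
      (by linarith)
  -- Step 1: per `y`, gcd extraction, characters, window adjustment
  have hstep : ∀ y ∈ Finset.range X,
      ‖∑ n ∈ (Finset.Ioc y (y + H)).filter (fun n => n % m = b), Lf n‖ ≤
        (m'.totient : ℝ)⁻¹ * ∑ χ : DirichletCharacter ℂ m',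
          (‖∑ n ∈ Finset.Ico (y / g + 1) (y / g + 1 + K), χ n * Lf n‖ + 1) := by
    intro y _
    rw [hLf, sum_Ioc_modEq_liouville_eq hm hb y H, norm_mul, norm_liouville_complex_eq_one (by omega), one_mul]
    have hE := norm_sum_filter_modEq_le_sum_char hcop
      (Finset.Ioc (y / g) ((y + H) / g)) (ArithmeticFunction.liouville : ArithmeticFunction ℂ)
    rw [Nat.mod_eq_of_lt hb'm'] at hE
    refine hE.trans ?_
    apply mul_le_mul_of_nonneg_left _ (by positivity)
    refine Finset.sum_le_sum fun χ _ => ?_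
    obtain ⟨hb1, hb2⟩ := add_div_bounds y H hg
    refine norm_sum_Ioc_le_norm_sum_Ico_add_one (F := fun n => χ n * Lf n) (fun n => ?_) hb1 hb2
    show ‖χ (n : ZMod m') * Lf n‖ ≤ 1
    rw [norm_mul]
    have h1 := χ.norm_le_one (n : ZMod m')
    have h2 := norm_liouville_complex_le_one n
    have h0 := norm_nonneg (χ (n : ZMod m'))
    nlinarith
  -- Step 2: sum over `y`, swap, and bound each character's contribution
  have hchar : ∀ χ : DirichletCharacter ℂ m',
      ∑ y ∈ Finset.range X, (‖∑ n ∈ Finset.Ico (y / g + 1) (y / g + 1 + K), χ n * Lf n‖ + 1) ≤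
        g * (2 * (C₁ * (Real.log (Real.log K') / Real.log K' + 1 / Real.log X ^ (1 / 700 : ℝ)) *
          K' * X)) + X := by
    intro χ
    rw [Finset.sum_add_distrib, Finset.sum_const, Finset.card_range, nsmul_eq_mul, mul_one]
    refine add_le_add ?_ le_rfl
    have hfib := sum_range_comp_div_le (f := fun k => ‖∑ n ∈ Finset.Ico k (k + K), χ n * Lf n‖)
      (fun k => norm_nonneg _) hg X
    refine hfib.trans (mul_le_mul_of_nonneg_left ?_ (by positivity))
    have hW := sum_norm_charWindow_le hA χ (by omega) hKX hlev'
    rw [← hK'] at hW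
    refine hW.trans ?_
    -- `C₀ ≤ C₁` and the rate at `K'` is nonnegative
    have hrate0 : 0 ≤ Real.log (Real.log K') / Real.log K' + 1 / Real.log X ^ (1 / 700 : ℝ) := by
      have hlogK : 1 < Real.log K' := by
        rw [Real.lt_log_iff_exp_lt (by linarith)]; linarith [Real.exp_one_lt_three]
      have : 0 ≤ Real.log (Real.log K') := Real.log_nonneg hlogK.le
      have hX0 : (0 : ℝ) < X := by linarith
      have hlogX : 0 ≤ Real.log X := Real.log_nonneg (by linarith)
      positivity
    have hC01 : C₀ ≤ C₁ := le_max_left _ _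
    have hK'0 : (0 : ℝ) ≤ K' := by linarith
    have hX0 : (0 : ℝ) ≤ X := by positivity
    have := mul_le_mul_of_nonneg_right hC01 (mul_nonneg (mul_nonneg hrate0 hK'0) hX0)
    linarith [this]
  -- Step 3: assemble
  have hcard : (Finset.univ : Finset (DirichletCharacter ℂ m')).card = m'.totient := by
    rw [Finset.card_univ, ← Nat.card_eq_fintype_card]
    exact DirichletCharacter.card_eq_totient_of_hasEnoughRootsOfUnity ℂ m'
  have hφpos : (0 : ℝ) < m'.totient := by exact_mod_cast Nat.totient_pos.mpr hm'pos
  calc ∑ y ∈ Finset.range X, ‖∑ n ∈ (Finset.Ioc y (y + H)).filter (fun n => n % m = b), Lf n‖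
      ≤ ∑ y ∈ Finset.range X, (m'.totient : ℝ)⁻¹ * ∑ χ : DirichletCharacter ℂ m',
          (‖∑ n ∈ Finset.Ico (y / g + 1) (y / g + 1 + K), χ n * Lf n‖ + 1) := Finset.sum_le_sum hstep
    _ = (m'.totient : ℝ)⁻¹ * ∑ χ : DirichletCharacter ℂ m', ∑ y ∈ Finset.range X,
          (‖∑ n ∈ Finset.Ico (y / g + 1) (y / g + 1 + K), χ n * Lf n‖ + 1) := by
        rw [← Finset.mul_sum, Finset.sum_comm]
    _ ≤ (m'.totient : ℝ)⁻¹ * ∑ _χ : DirichletCharacter ℂ m',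
          (g * (2 * (C₁ * (Real.log (Real.log K') / Real.log K' + 1 / Real.log X ^ (1 / 700 : ℝ)) *
            K' * X)) + X) := by
        apply mul_le_mul_of_nonneg_left _ (by positivity)
        exact Finset.sum_le_sum fun χ _ => hchar χ
    _ = g * (2 * (C₁ * (Real.log (Real.log K') / Real.log K' + 1 / Real.log X ^ (1 / 700 : ℝ)) *
            K' * X)) + X := by
        rw [Finset.sum_const, hcard, nsmul_eq_mul, ← mul_assoc, inv_mul_cancel₀ hφpos.ne', one_mul]
    _ ≤ 2 * C₁ * (Real.log (Real.log H) / Real.log (H / (2 * m)) + 1 / Real.log X ^ (1 / 700 : ℝ)) *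
          H * X + X := by
        refine add_le_add ?_ le_rfl
        -- rate at `K'` ≤ rate', and `g K' ≤ g K ≤ H`
        have hrate_le : Real.log (Real.log K') / Real.log K' + 1 / Real.log X ^ (1 / 700 : ℝ) ≤
            Real.log (Real.log H) / Real.log (H / (2 * m)) + 1 / Real.log X ^ (1 / 700 : ℝ) := by
          linarith [loglog_div_log_le hmR hHR hK'low hK'H]
        have hrate'0 : 0 ≤ Real.log (Real.log H) / Real.log (H / (2 * m)) + 1 / Real.log X ^ (1 / 700 : ℝ) := by
          have hlogH : 1 < Real.log H := by
            rw [Real.lt_log_iff_exp_lt (by linarith)]; linarith [Real.exp_one_lt_three]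
          have hlogH2m : 1 < Real.log (H / (2 * m)) := by
            have hm0 : (0 : ℝ) < m := by linarith
            have : (8 : ℝ) ≤ H / (2 * m) := by rw [le_div_iff₀ (by linarith)]; linarith
            rw [Real.lt_log_iff_exp_lt (by linarith)]; linarith [Real.exp_one_lt_three]
          have : 0 ≤ Real.log (Real.log H) := Real.log_nonneg hlogH.le
          have hX0 : (0 : ℝ) < X := by linarith
          have hlogX : 0 ≤ Real.log X := Real.log_nonneg (by linarith)
          positivity
        have hgK' : (g : ℝ) * K' ≤ H := by rw [hK']; nlinarith [show (0 : ℝ) < g by exact_mod_cast hg]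
        have hX0 : (0 : ℝ) ≤ X := by positivity
        have hC₁0 : 0 ≤ C₁ := le_max_right _ _
        have hK'0 : 0 ≤ K' := by linarith
        calc (g : ℝ) * (2 * (C₁ * (Real.log (Real.log K') / Real.log K' + 1 / Real.log X ^ (1 / 700 : ℝ)) * K' * X))
            = 2 * C₁ * (Real.log (Real.log K') / Real.log K' + 1 / Real.log X ^ (1 / 700 : ℝ)) * ((g : ℝ) * K') * X := by ring
          _ ≤ 2 * C₁ * (Real.log (Real.log H) / Real.log (H / (2 * m)) + 1 / Real.log X ^ (1 / 700 : ℝ)) * ((g : ℝ) * K') * X := by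
              apply mul_le_mul_of_nonneg_right _ hX0
              apply mul_le_mul_of_nonneg_right _ (by positivity)
              exact mul_le_mul_of_nonneg_left hrate_le (by positivity)
          _ ≤ 2 * C₁ * (Real.log (Real.log H) / Real.log (H / (2 * m)) + 1 / Real.log X ^ (1 / 700 : ℝ)) * H * X := by
              apply mul_le_mul_of_nonneg_right _ hX0
              exact mul_le_mul_of_nonneg_left hgK' (by positivity)

end Teravainen2024

end Literature.NumberTheory.Sieve
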